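import Mathlib.MeasureTheory.Integral.Prod
import Mathlib.Analysis.Complex.CauchyIntegral
import Mathlib.Analysis.Calculus.FDeriv.Analytic
import Mathlib.Analysis.Calculus.IteratedDeriv.Defs
import Mathlib.Topology.Algebra.InfiniteSum.Real
import Mathlib.Data.Int.Interval
import Mathlib.Algebra.BigOperators.Group.Finset.Indicator
import Literature.NumberTheory.LFunctions.WeilZeroSum
import HarnessLib

/-!
# Stub `stub_zeroSampling` of the line `Sketch` (crux `WeilGroundState.GroundStatesConvergeToXi`,
item stmt-RiemannHypothesis-1527, rev L9)

The RH-free **sampling inequality** at the non-trivial zeros of `ζ`, assembled from its three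
inputs (taken as hypotheses): (A) a Sobolev bound on unit boxes of the critical strip for an
entire `F`, `‖F(β+iγ)‖² ≤ 4 ∫_{[τ-1,τ+1]} ∫_{[0,1]} (‖F‖² + 2‖F'‖² + ‖F''‖²)`; (B) the Plancherel
budget on vertical lines for `û = weilMellin u`, `u ∈ L²` vanishing off `[-a, a]`;
(D) the zero count `∑_{|Im ρ - τ| ≤ 1/2} m(ρ) ≤ C₀ log(|τ| + 2)`.

Proof: group a finite set of zeros by the nearest integer `k = round (Im ρ)`; on the fibre,
(A) with `τ = k` and (D) give `∑ m(ρ)‖û(ρ)‖²/log(|Im ρ|+2) ≤ 8 C₀ I(k)` with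
`I(k) = ∫_{[k-1,k+1]} G`, `G(t) = ∫_{x ∈ [0,1]} Φ(x,t)`, using `log(|k|+2) ≤ 2 log(|Im ρ|+2)`;
the windows `[k-1, k+1]`, `k ∈ ℤ`, cover every real point at most three times, so
`∑_k I(k) ≤ 3 ∫ G`; Fubini (`integrable_prod_iff`, `integral_integral_swap`) and (B) give
`∫ G = ∫_{[0,1]} ∫_ℝ Φ ≤ 2π(1+a²)² eᵃ ‖u‖₂²`.  Uniform bounds on finite partial sums give
summability (`summable_of_sum_le`) and the `tsum` bound; the constant is `C = 48 π C₀`.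
-/

set_option linter.dupNamespace false

noncomputable section

open MeasureTheory Complex Filter Set
open scoped Real Topology ComplexConjugate

namespace Summit.RiemannHypothesis.RiemannHypothesis.Theorems.GroundStatesConvergeToXi

open Literature.NumberTheory.LFunctions

/-- At most three integers `k` satisfy `t ∈ [k-1, k+1]` for a given real `t`. [folklore] -/
theorem zeroSampling_card_filter_le (S : Finset ℤ) (t : ℝ) :
    (S.filter fun k : ℤ => t ∈ Icc ((k : ℝ) - 1) ((k : ℝ) + 1)).card ≤ 3 := by
  have hsub : (S.filter fun k : ℤ => t ∈ Icc ((k : ℝ) - 1) ((k : ℝ) + 1)) ⊆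
      Finset.Ioc (⌊t + 1⌋ - 3) ⌊t + 1⌋ := by
    intro k hk
    rw [Finset.mem_filter] at hk
    obtain ⟨-, h1, h2⟩ := hk
    rw [Finset.mem_Ioc]
    refine ⟨?_, Int.le_floor.2 (by linarith)⟩
    have h3 : ((⌊t + 1⌋ : ℤ) : ℝ) ≤ t + 1 := Int.floor_le _
    have h4 : ((⌊t + 1⌋ - 3 : ℤ) : ℝ) < k := by push_cast; linarith
    exact_mod_cast h4
  calc (S.filter fun k : ℤ => t ∈ Icc ((k : ℝ) - 1) ((k : ℝ) + 1)).card
      ≤ (Finset.Ioc (⌊t + 1⌋ - 3) ⌊t + 1⌋).card := Finset.card_le_card hsub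
    _ = 3 := by rw [Int.card_Ioc, sub_sub_cancel]; rfl

/-- Pointwise overlap bound: `∑_{k ∈ S} 1_{[k-1,k+1]}(t) G(t) ≤ 3 G(t)` for `G ≥ 0`. [folklore] -/
theorem zeroSampling_sum_indicator_le {G : ℝ → ℝ} (hnn : ∀ t, 0 ≤ G t) (S : Finset ℤ)
    (t : ℝ) :
    ∑ k ∈ S, (Icc ((k : ℝ) - 1) ((k : ℝ) + 1)).indicator G t ≤ 3 * G t := by
  have h1 : ∑ k ∈ S, (Icc ((k : ℝ) - 1) ((k : ℝ) + 1)).indicator G t =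
      ∑ k ∈ S.filter (fun k : ℤ => t ∈ Icc ((k : ℝ) - 1) ((k : ℝ) + 1)), G t := by
    exact Finset.sum_indicator_eq_sum_filter S (fun _ => G)
      (fun k : ℤ => Icc ((k : ℝ) - 1) ((k : ℝ) + 1)) (fun _ => t)
  rw [h1, Finset.sum_const, nsmul_eq_mul]
  have h3 : ((S.filter fun k : ℤ => t ∈ Icc ((k : ℝ) - 1) ((k : ℝ) + 1)).card : ℝ) ≤ 3 := by
    exact_mod_cast zeroSampling_card_filter_le S t
  exact mul_le_mul_of_nonneg_right h3 (hnn t)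

/-- Window overlap: for an integrable `G ≥ 0` and a finite set `S` of integers,
`∑_{k ∈ S} ∫_{[k-1,k+1]} G ≤ 3 ∫ G`. [folklore] -/
theorem zeroSampling_sum_window_le {G : ℝ → ℝ} (hG : Integrable G) (hnn : ∀ t, 0 ≤ G t)
    (S : Finset ℤ) :
    ∑ k ∈ S, ∫ t in Icc ((k : ℝ) - 1) ((k : ℝ) + 1), G t ≤ 3 * ∫ t, G t := by
  have hI : ∀ k : ℤ, Integrable ((Icc ((k : ℝ) - 1) ((k : ℝ) + 1)).indicator G) :=
    fun k => hG.indicator measurableSet_Icc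
  calc ∑ k ∈ S, ∫ t in Icc ((k : ℝ) - 1) ((k : ℝ) + 1), G t
      = ∑ k ∈ S, ∫ t, (Icc ((k : ℝ) - 1) ((k : ℝ) + 1)).indicator G t :=
        Finset.sum_congr rfl fun k _ => (integral_indicator measurableSet_Icc).symm
    _ = ∫ t, ∑ k ∈ S, (Icc ((k : ℝ) - 1) ((k : ℝ) + 1)).indicator G t :=
        (integral_finsetSum S fun k _ => hI k).symm
    _ ≤ ∫ t, 3 * G t :=
        integral_mono (integrable_finsetSum S fun k _ => hI k) (hG.const_mul 3)
          fun t => zeroSampling_sum_indicator_le hnn S t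
    _ = 3 * ∫ t, G t := integral_const_mul 3 G

/-- Fubini budget: if `Φ ≥ 0` is jointly continuous, `t ↦ Φ(x,t)` is integrable with
`∫ Φ(x,t) dt ≤ M` for every `x ∈ [0,1]`, then `G(t) = ∫_{x ∈ [0,1]} Φ(x,t)` is integrable and
`∫ G ≤ M`. [folklore] -/
theorem zeroSampling_budget {φ : ℝ → ℝ → ℝ} {M : ℝ}
    (hcont : Continuous (Function.uncurry φ)) (hnn : ∀ x t, 0 ≤ φ x t)
    (hint : ∀ x ∈ Icc (0 : ℝ) 1, Integrable (φ x))
    (hle : ∀ x ∈ Icc (0 : ℝ) 1, ∫ t, φ x t ≤ M) :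
    Integrable (fun t : ℝ => ∫ x in Icc (0 : ℝ) 1, φ x t) ∧
      ∫ t : ℝ, ∫ x in Icc (0 : ℝ) 1, φ x t ≤ M := by
  have hprod : Integrable (Function.uncurry φ)
      ((volume.restrict (Icc (0 : ℝ) 1)).prod volume) := by
    rw [integrable_prod_iff hcont.aestronglyMeasurable]
    refine ⟨?_, ?_⟩
    · rw [ae_restrict_iff' measurableSet_Icc]
      exact ae_of_all _ fun x hx => hint x hx
    · have hmeas : AEStronglyMeasurable
          (fun x : ℝ => ∫ t : ℝ, ‖Function.uncurry φ (x, t)‖)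
          (volume.restrict (Icc (0 : ℝ) 1)) :=
        hcont.norm.aestronglyMeasurable.integral_prod_right'
      refine Integrable.mono' (integrable_const M) hmeas ?_
      rw [ae_restrict_iff' measurableSet_Icc]
      refine ae_of_all _ fun x hx => ?_
      have h1 : ∫ t : ℝ, ‖Function.uncurry φ (x, t)‖ = ∫ t, φ x t :=
        integral_congr_ae (ae_of_all _ fun t => Real.norm_of_nonneg (hnn x t))
      rw [h1, Real.norm_of_nonneg (integral_nonneg (hnn x))]
      exact hle x hx
  refine ⟨hprod.integral_prod_right, ?_⟩
  rw [← integral_integral_swap hprod]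
  calc ∫ x in Icc (0 : ℝ) 1, ∫ t, φ x t
      ≤ ∫ x in Icc (0 : ℝ) 1, M := by
        refine integral_mono_ae hprod.integral_prod_left (integrable_const M) ?_
        rw [Filter.EventuallyLE, ae_restrict_iff' measurableSet_Icc]
        exact ae_of_all _ hle
    _ = M := by
        rw [setIntegral_const, Real.volume_real_Icc_of_le zero_le_one, sub_zero, one_smul]

/-- `log(|round γ| + 2) ≤ 2 log(|γ| + 2)`. [folklore] -/
theorem zeroSampling_log_le (γ : ℝ) :
    Real.log (|((round γ : ℤ) : ℝ)| + 2) ≤ 2 * Real.log (|γ| + 2) := by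
  have hr : |((round γ : ℤ) : ℝ)| ≤ |γ| + 1 / 2 := by
    have h1 := abs_sub_round γ
    have h2 := abs_sub_abs_le_abs_sub ((round γ : ℤ) : ℝ) γ
    rw [abs_sub_comm] at h2
    linarith
  have hγ : 0 ≤ |γ| := abs_nonneg γ
  calc Real.log (|((round γ : ℤ) : ℝ)| + 2) ≤ Real.log ((|γ| + 2) ^ 2) := by
        refine Real.log_le_log (by positivity) ?_
        nlinarith
    _ = 2 * Real.log (|γ| + 2) := by
        rw [Real.log_pow]; norm_num

/-- The combinatorial zero sum: if every non-trivial zero `ρ` satisfies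
`‖F ρ‖² ≤ 4 I(round (Im ρ))` with `I ≥ 0`, and unit windows carry `≤ C₀ log(|τ|+2)` zeros, then
`∑_{ρ ∈ T} m(ρ)‖F ρ‖²/log(|Im ρ|+2) ≤ 8 C₀ ∑_k I(k)` over the rounded ordinates `k` of `T`. [folklore] -/
theorem zeroSampling_finset_le {F : ℂ → ℂ} {I : ℤ → ℝ} {C₀ : ℝ}
    (hcount : ∀ (τ : ℝ) (T : Finset ℂ),
      (∀ ρ ∈ T, ρ ∈ ZetaZeros.riemannZetaNontrivialZeros ∧ |ρ.im - τ| ≤ 1 / 2) →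
        ∑ ρ ∈ T, (riemannZetaZeroOrder ρ : ℝ) ≤ C₀ * Real.log (|τ| + 2))
    (hI : ∀ k, 0 ≤ I k)
    (hF : ∀ ρ ∈ ZetaZeros.riemannZetaNontrivialZeros, ‖F ρ‖ ^ 2 ≤ 4 * I (round ρ.im))
    (T : Finset ℂ) (hT : ∀ ρ ∈ T, ρ ∈ ZetaZeros.riemannZetaNontrivialZeros) :
    ∑ ρ ∈ T, (riemannZetaZeroOrder ρ : ℝ) * ‖F ρ‖ ^ 2 / Real.log (|ρ.im| + 2) ≤
      8 * C₀ * ∑ k ∈ T.image (fun ρ : ℂ => round ρ.im), I k := by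
  have hmaps : ∀ ρ ∈ T, round ρ.im ∈ T.image (fun ρ : ℂ => round ρ.im) :=
    fun ρ hρ => Finset.mem_image_of_mem (fun ρ : ℂ => round ρ.im) hρ
  rw [← Finset.sum_fiberwise_of_maps_to hmaps, Finset.mul_sum]
  refine Finset.sum_le_sum fun k _ => ?_
  have hk0 : 0 ≤ |(k : ℝ)| := abs_nonneg _
  have hLk : 0 < Real.log (|(k : ℝ)| + 2) := Real.log_pos (by linarith)
  have hterm : ∀ ρ ∈ T.filter (fun ρ : ℂ => round ρ.im = k),
      (riemannZetaZeroOrder ρ : ℝ) * ‖F ρ‖ ^ 2 / Real.log (|ρ.im| + 2) ≤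
        (8 * I k / Real.log (|(k : ℝ)| + 2)) * (riemannZetaZeroOrder ρ : ℝ) := by
    intro ρ hρ
    rw [Finset.mem_filter] at hρ
    obtain ⟨hρT, hk'⟩ := hρ
    have hz := hT ρ hρT
    have hm : (0 : ℝ) ≤ riemannZetaZeroOrder ρ := by
      exact_mod_cast riemannZetaZeroOrder_nonneg (ZetaZeros.riemannZetaNontrivialZeros.ne_one hz)
    have hγ0 : 0 ≤ |ρ.im| := abs_nonneg _
    have hLρ : 0 < Real.log (|ρ.im| + 2) := Real.log_pos (by linarith)
    have hlog : Real.log (|(k : ℝ)| + 2) ≤ 2 * Real.log (|ρ.im| + 2) := by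
      rw [← hk']; exact zeroSampling_log_le ρ.im
    have hFρ : ‖F ρ‖ ^ 2 ≤ 4 * I k := by rw [← hk']; exact hF ρ hz
    have hIk := hI k
    calc (riemannZetaZeroOrder ρ : ℝ) * ‖F ρ‖ ^ 2 / Real.log (|ρ.im| + 2)
        ≤ (riemannZetaZeroOrder ρ : ℝ) * (4 * I k) / Real.log (|ρ.im| + 2) := by gcongr
      _ = (riemannZetaZeroOrder ρ : ℝ) * (4 * I k) * 2 / (Real.log (|ρ.im| + 2) * 2) :=
          (mul_div_mul_right _ _ two_ne_zero).symm
      _ ≤ (riemannZetaZeroOrder ρ : ℝ) * (4 * I k) * 2 / Real.log (|(k : ℝ)| + 2) :=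
          div_le_div_of_nonneg_left (by positivity) hLk (by linarith)
      _ = (8 * I k / Real.log (|(k : ℝ)| + 2)) * (riemannZetaZeroOrder ρ : ℝ) := by ring
  calc ∑ ρ ∈ T with round ρ.im = k,
        (riemannZetaZeroOrder ρ : ℝ) * ‖F ρ‖ ^ 2 / Real.log (|ρ.im| + 2)
      ≤ ∑ ρ ∈ T with round ρ.im = k,
          (8 * I k / Real.log (|(k : ℝ)| + 2)) * (riemannZetaZeroOrder ρ : ℝ) :=
        Finset.sum_le_sum hterm
    _ = (8 * I k / Real.log (|(k : ℝ)| + 2)) *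
          ∑ ρ ∈ T with round ρ.im = k, (riemannZetaZeroOrder ρ : ℝ) := by
        rw [Finset.mul_sum]
    _ ≤ (8 * I k / Real.log (|(k : ℝ)| + 2)) * (C₀ * Real.log (|(k : ℝ)| + 2)) := by
        refine mul_le_mul_of_nonneg_left (hcount k _ fun ρ hρ => ?_)
          (div_nonneg (by linarith [hI k]) hLk.le)
        rw [Finset.mem_filter] at hρ
        have hk' : round ρ.im = k := hρ.2
        refine ⟨hT ρ hρ.1, ?_⟩
        rw [← hk']
        exact abs_sub_round ρ.im
    _ = 8 * C₀ * I k := by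
        field_simp

/-- The analytic assembly of the sampling inequality for continuous `F, F₁, F₂` (in the
application `F = û`, `F₁ = û'`, `F₂ = û''`): the window count, the box-Sobolev samples
`‖F ρ‖² ≤ 4 ∫_{[k-1,k+1]} ∫_{[0,1]} Φ` (`k = round (Im ρ)`,
`Φ = ‖F‖² + 2‖F₁‖² + ‖F₂‖²` on vertical lines) and the line budget `∫ Φ(x, ·) ≤ B`
(`x ∈ [0,1]`) give `∑_ρ m(ρ)‖F ρ‖²/log(|Im ρ|+2) ≤ 24 C₀ B`, summably. [folklore] -/
theorem zeroSampling_main {F F₁ F₂ : ℂ → ℂ} {C₀ B : ℝ} (hC₀ : 0 ≤ C₀)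
    (hcount : ∀ (τ : ℝ) (T : Finset ℂ),
      (∀ ρ ∈ T, ρ ∈ ZetaZeros.riemannZetaNontrivialZeros ∧ |ρ.im - τ| ≤ 1 / 2) →
        ∑ ρ ∈ T, (riemannZetaZeroOrder ρ : ℝ) ≤ C₀ * Real.log (|τ| + 2))
    (hF : Continuous F) (hF₁ : Continuous F₁) (hF₂ : Continuous F₂)
    (hint : ∀ x ∈ Icc (0 : ℝ) 1, Integrable fun t : ℝ =>
      ‖F (x + t * I)‖ ^ 2 + 2 * ‖F₁ (x + t * I)‖ ^ 2 + ‖F₂ (x + t * I)‖ ^ 2)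
    (hB : ∀ x ∈ Icc (0 : ℝ) 1,
      ∫ t : ℝ, (‖F (x + t * I)‖ ^ 2 + 2 * ‖F₁ (x + t * I)‖ ^ 2 + ‖F₂ (x + t * I)‖ ^ 2) ≤ B)
    (hsample : ∀ ρ ∈ ZetaZeros.riemannZetaNontrivialZeros,
      ‖F ρ‖ ^ 2 ≤ 4 * ∫ t in Icc ((round ρ.im : ℝ) - 1) ((round ρ.im : ℝ) + 1),
        ∫ x in Icc (0 : ℝ) 1,
          (‖F (x + t * I)‖ ^ 2 + 2 * ‖F₁ (x + t * I)‖ ^ 2 + ‖F₂ (x + t * I)‖ ^ 2)) :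
    Summable (fun ρ : ZetaZeros.riemannZetaNontrivialZeros =>
        (riemannZetaZeroOrder (ρ : ℂ) : ℝ) * ‖F ρ‖ ^ 2 / Real.log (|(ρ : ℂ).im| + 2)) ∧
      ∑' ρ : ZetaZeros.riemannZetaNontrivialZeros,
          (riemannZetaZeroOrder (ρ : ℂ) : ℝ) * ‖F ρ‖ ^ 2 / Real.log (|(ρ : ℂ).im| + 2) ≤
        24 * C₀ * B := by
  have hcontφ : Continuous (Function.uncurry fun (x t : ℝ) =>
      ‖F (x + t * I)‖ ^ 2 + 2 * ‖F₁ (x + t * I)‖ ^ 2 + ‖F₂ (x + t * I)‖ ^ 2) := by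
    show Continuous fun p : ℝ × ℝ =>
      ‖F ((p.1 : ℂ) + (p.2 : ℂ) * I)‖ ^ 2 + 2 * ‖F₁ ((p.1 : ℂ) + (p.2 : ℂ) * I)‖ ^ 2 +
        ‖F₂ ((p.1 : ℂ) + (p.2 : ℂ) * I)‖ ^ 2
    fun_prop
  have hnn : ∀ x t : ℝ,
      0 ≤ ‖F (x + t * I)‖ ^ 2 + 2 * ‖F₁ (x + t * I)‖ ^ 2 + ‖F₂ (x + t * I)‖ ^ 2 :=
    fun x t => by positivity
  obtain ⟨hGint, hGle⟩ := zeroSampling_budget (M := B)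
    (φ := fun (x t : ℝ) => ‖F (x + t * I)‖ ^ 2 + 2 * ‖F₁ (x + t * I)‖ ^ 2 + ‖F₂ (x + t * I)‖ ^ 2)
    hcontφ hnn hint hB
  have hGnn : ∀ t : ℝ, 0 ≤ ∫ x in Icc (0 : ℝ) 1,
      (‖F (x + t * I)‖ ^ 2 + 2 * ‖F₁ (x + t * I)‖ ^ 2 + ‖F₂ (x + t * I)‖ ^ 2) :=
    fun t => integral_nonneg fun x => hnn x t
  have hInn : ∀ k : ℤ, 0 ≤ ∫ t in Icc ((k : ℝ) - 1) ((k : ℝ) + 1), ∫ x in Icc (0 : ℝ) 1,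
      (‖F (x + t * I)‖ ^ 2 + 2 * ‖F₁ (x + t * I)‖ ^ 2 + ‖F₂ (x + t * I)‖ ^ 2) :=
    fun k => integral_nonneg fun t => hGnn t
  have hwin : ∀ S : Finset ℤ,
      ∑ k ∈ S, ∫ t in Icc ((k : ℝ) - 1) ((k : ℝ) + 1), ∫ x in Icc (0 : ℝ) 1,
        (‖F (x + t * I)‖ ^ 2 + 2 * ‖F₁ (x + t * I)‖ ^ 2 + ‖F₂ (x + t * I)‖ ^ 2) ≤ 3 * B :=
    fun S => (zeroSampling_sum_window_le hGint hGnn S).trans (by linarith)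
  have hfnn : ∀ ρ : ZetaZeros.riemannZetaNontrivialZeros,
      0 ≤ (riemannZetaZeroOrder (ρ : ℂ) : ℝ) * ‖F ρ‖ ^ 2 / Real.log (|(ρ : ℂ).im| + 2) := by
    intro ρ
    have hm : (0 : ℝ) ≤ riemannZetaZeroOrder (ρ : ℂ) := by
      exact_mod_cast riemannZetaZeroOrder_nonneg (ZetaZeros.riemannZetaNontrivialZeros.ne_one ρ.2)
    have hγ0 : 0 ≤ |(ρ : ℂ).im| := abs_nonneg _
    exact div_nonneg (mul_nonneg hm (sq_nonneg _)) (Real.log_nonneg (by linarith))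
  have hsum : ∀ T : Finset ZetaZeros.riemannZetaNontrivialZeros,
      ∑ ρ ∈ T, (riemannZetaZeroOrder (ρ : ℂ) : ℝ) * ‖F ρ‖ ^ 2 / Real.log (|(ρ : ℂ).im| + 2) ≤
        24 * C₀ * B := by
    intro T
    have h1 : ∑ ρ ∈ T, (riemannZetaZeroOrder (ρ : ℂ) : ℝ) * ‖F ρ‖ ^ 2 /
          Real.log (|(ρ : ℂ).im| + 2) =
        ∑ ρ ∈ T.map (Function.Embedding.subtype _),
          (riemannZetaZeroOrder ρ : ℝ) * ‖F ρ‖ ^ 2 / Real.log (|ρ.im| + 2) := by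
      rw [Finset.sum_map]; rfl
    rw [h1]
    have hT' : ∀ ρ ∈ T.map (Function.Embedding.subtype _),
        ρ ∈ ZetaZeros.riemannZetaNontrivialZeros := by
      intro ρ hρ
      rw [Finset.mem_map] at hρ
      obtain ⟨ρ', -, rfl⟩ := hρ
      exact ρ'.2
    refine (zeroSampling_finset_le
      (I := fun k : ℤ => ∫ t in Icc ((k : ℝ) - 1) ((k : ℝ) + 1), ∫ x in Icc (0 : ℝ) 1,
        (‖F (x + t * I)‖ ^ 2 + 2 * ‖F₁ (x + t * I)‖ ^ 2 + ‖F₂ (x + t * I)‖ ^ 2))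
      hcount hInn (fun ρ hρ => hsample ρ hρ) _ hT').trans ?_
    calc 8 * C₀ * ∑ k ∈ (T.map (Function.Embedding.subtype _)).image (fun ρ : ℂ => round ρ.im),
          ∫ t in Icc ((k : ℝ) - 1) ((k : ℝ) + 1), ∫ x in Icc (0 : ℝ) 1,
            (‖F (x + t * I)‖ ^ 2 + 2 * ‖F₁ (x + t * I)‖ ^ 2 + ‖F₂ (x + t * I)‖ ^ 2)
        ≤ 8 * C₀ * (3 * B) := mul_le_mul_of_nonneg_left (hwin _) (by positivity)
      _ = 24 * C₀ * B := by ring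
  have hsumm : Summable (fun ρ : ZetaZeros.riemannZetaNontrivialZeros =>
      (riemannZetaZeroOrder (ρ : ℂ) : ℝ) * ‖F ρ‖ ^ 2 / Real.log (|(ρ : ℂ).im| + 2)) :=
    summable_of_sum_le hfnn hsum
  exact ⟨hsumm, hsumm.tsum_le_of_sum_le hsum⟩

/-- **Stub W6c — `zeroSampling` (RH-free; THE SAMPLING INEQUALITY; takes W6a, W6b, W6d as
hypotheses).**  There is an absolute `C > 0` such that for every window `a > 0` and every `u ∈ L²`
vanishing a.e. off `[-a, a]`,
`Σ_ρ m(ρ) ‖û(ρ)‖² / log(|Im ρ| + 2) ≤ C (1 + a²)² eᵃ ∫‖u‖²`,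
the series over the non-trivial zeros being summable.  Proof: group the zeros by the nearest
integer ordinate `k = round (Im ρ)`; in each window the box-Sobolev bound (A) bounds `‖û(ρ)‖²`
by `4×` the box integral of `‖û‖² + 2‖û'‖² + ‖û''‖²` over `[k-1,k+1] × [0,1]`, the window
carries `≤ C₀ log(|k|+2)` zeros (D) while `log(|k|+2) ≤ 2 log(|Im ρ|+2)`; the boxes overlap at
most threefold, and (B) with Fubini bounds `∫_0^1 ∫_ℝ (‖û‖² + 2‖û'‖² + ‖û''‖²) dt dx ≤
2π(1 + 2a² + a⁴) eᵃ ‖u‖₂²`; `C = 48 π C₀`. [folklore] -/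
theorem stub_zeroSampling :
    (∀ (F : ℂ → ℂ), Differentiable ℂ F → ∀ (β γ τ : ℝ), β ∈ Icc (0 : ℝ) 1 → |γ - τ| ≤ 1 / 2 →
      ‖F (β + γ * I)‖ ^ 2 ≤
        4 * ∫ t in Icc (τ - 1) (τ + 1), ∫ x in Icc (0 : ℝ) 1,
          (‖F (x + t * I)‖ ^ 2 + 2 * ‖deriv F (x + t * I)‖ ^ 2 +
            ‖deriv (deriv F) (x + t * I)‖ ^ 2)) →
    (∀ (a : ℝ) (u : ℝ → ℂ), 0 < a → MemLp u 2 volume → (∀ᵐ t : ℝ, t ∉ Icc (-a) a → u t = 0) →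
      Differentiable ℂ (weilMellin u) ∧
      (∀ n : ℕ, iteratedDeriv n (weilMellin u) = weilMellin (fun y : ℝ => u y * (y : ℂ) ^ n)) ∧
      ∀ (n : ℕ) (x : ℝ), x ∈ Icc (0 : ℝ) 1 →
        Integrable (fun t : ℝ => ‖weilMellin (fun y : ℝ => u y * (y : ℂ) ^ n) (x + t * I)‖ ^ 2) ∧
        ∫ t : ℝ, ‖weilMellin (fun y : ℝ => u y * (y : ℂ) ^ n) (x + t * I)‖ ^ 2 ≤
          2 * π * a ^ (2 * n) * Real.exp a * ∫ y : ℝ, ‖u y‖ ^ 2) →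
    ((∃ C : ℝ, 0 < C ∧ ∀ (τ : ℝ) (F : Finset ℂ),
      (∀ ρ ∈ F, ρ ∈ ZetaZeros.riemannZetaNontrivialZeros ∧ |ρ.im - τ| ≤ 1 / 2) →
        ∑ ρ ∈ F, (riemannZetaZeroOrder ρ : ℝ) ≤ C * Real.log (|τ| + 2)) ∧
    (∀ s : ℂ, Summable fun ρ : ZetaZeros.riemannZetaNontrivialZeros =>
      (riemannZetaZeroOrder (ρ : ℂ) : ℝ) * Real.log (|(ρ : ℂ).im| + 2) / ‖s - (ρ : ℂ)‖ ^ 2)) →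
    ∃ C : ℝ, 0 < C ∧ ∀ (a : ℝ) (u : ℝ → ℂ), 0 < a → MemLp u 2 volume →
      (∀ᵐ t : ℝ, t ∉ Icc (-a) a → u t = 0) →
        Summable (fun ρ : ZetaZeros.riemannZetaNontrivialZeros =>
          (riemannZetaZeroOrder (ρ : ℂ) : ℝ) * ‖weilMellin u ρ‖ ^ 2 / Real.log (|(ρ : ℂ).im| + 2)) ∧
        ∑' ρ : ZetaZeros.riemannZetaNontrivialZeros,
            (riemannZetaZeroOrder (ρ : ℂ) : ℝ) * ‖weilMellin u ρ‖ ^ 2 / Real.log (|(ρ : ℂ).im| + 2) ≤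
          C * (1 + a ^ 2) ^ 2 * Real.exp a * ∫ y : ℝ, ‖u y‖ ^ 2 := by
  intro HA HB HD
  obtain ⟨C₀, hC₀, hcount⟩ := HD.1
  refine ⟨48 * π * C₀, by positivity, fun a u ha hu hae => ?_⟩
  obtain ⟨hdiff, hder, hbud⟩ := HB a u ha hu hae
  -- the derivatives of `û = weilMellin u` and their continuity
  have hF1 : deriv (weilMellin u) = weilMellin (fun y : ℝ => u y * (y : ℂ) ^ 1) := by
    have h := hder 1; rw [iteratedDeriv_one] at h; exact h
  have hF2 : deriv (deriv (weilMellin u)) = weilMellin (fun y : ℝ => u y * (y : ℂ) ^ 2) := by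
    have h := hder 2; rw [iteratedDeriv_succ, iteratedDeriv_one] at h; exact h
  have hF0 : weilMellin (fun y : ℝ => u y * (y : ℂ) ^ 0) = weilMellin u := by
    rw [← hder 0, iteratedDeriv_zero]
  have hdF : Differentiable ℂ (deriv (weilMellin u)) := fun z =>
    ((hdiff.analyticAt z).deriv).differentiableAt
  have hddF : Differentiable ℂ (deriv (deriv (weilMellin u))) := fun z =>
    ((hdF.analyticAt z).deriv).differentiableAt
  have hc0 : Continuous (weilMellin u) := hdiff.continuous
  have hc1 : Continuous (weilMellin (fun y : ℝ => u y * (y : ℂ) ^ 1)) := hF1 ▸ hdF.continuous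
  have hc2 : Continuous (weilMellin (fun y : ℝ => u y * (y : ℂ) ^ 2)) := hF2 ▸ hddF.continuous
  -- the samples (A)
  have hsample : ∀ ρ ∈ ZetaZeros.riemannZetaNontrivialZeros,
      ‖weilMellin u ρ‖ ^ 2 ≤ 4 * ∫ t in Icc ((round ρ.im : ℝ) - 1) ((round ρ.im : ℝ) + 1),
        ∫ x in Icc (0 : ℝ) 1,
          (‖weilMellin u (x + t * I)‖ ^ 2 +
            2 * ‖weilMellin (fun y : ℝ => u y * (y : ℂ) ^ 1) (x + t * I)‖ ^ 2 +
            ‖weilMellin (fun y : ℝ => u y * (y : ℂ) ^ 2) (x + t * I)‖ ^ 2) := by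
    intro ρ hρ
    have hβ : ρ.re ∈ Icc (0 : ℝ) 1 :=
      ⟨(ZetaZeros.riemannZetaNontrivialZeros.re_pos hρ).le,
        (ZetaZeros.riemannZetaNontrivialZeros.re_lt_one hρ).le⟩
    have h := HA (weilMellin u) hdiff ρ.re ρ.im (round ρ.im) hβ (abs_sub_round ρ.im)
    rw [re_add_im, hF2, hF1] at h
    exact h
  -- integrability and the budget (B)
  have hint : ∀ x ∈ Icc (0 : ℝ) 1, Integrable fun t : ℝ =>
      ‖weilMellin u (x + t * I)‖ ^ 2 +
        2 * ‖weilMellin (fun y : ℝ => u y * (y : ℂ) ^ 1) (x + t * I)‖ ^ 2 +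
        ‖weilMellin (fun y : ℝ => u y * (y : ℂ) ^ 2) (x + t * I)‖ ^ 2 := by
    intro x hx
    have h0 := (hbud 0 x hx).1
    rw [hF0] at h0
    exact (h0.add ((hbud 1 x hx).1.const_mul 2)).add (hbud 2 x hx).1
  have hB : ∀ x ∈ Icc (0 : ℝ) 1,
      ∫ t : ℝ, (‖weilMellin u (x + t * I)‖ ^ 2 +
        2 * ‖weilMellin (fun y : ℝ => u y * (y : ℂ) ^ 1) (x + t * I)‖ ^ 2 +
        ‖weilMellin (fun y : ℝ => u y * (y : ℂ) ^ 2) (x + t * I)‖ ^ 2) ≤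
        2 * π * (1 + a ^ 2) ^ 2 * Real.exp a * ∫ y : ℝ, ‖u y‖ ^ 2 := by
    intro x hx
    obtain ⟨h0i, h0b⟩ := hbud 0 x hx
    obtain ⟨h1i, h1b⟩ := hbud 1 x hx
    obtain ⟨h2i, h2b⟩ := hbud 2 x hx
    rw [hF0] at h0i h0b
    have e1 : ∫ t : ℝ, (‖weilMellin u (x + t * I)‖ ^ 2 +
        2 * ‖weilMellin (fun y : ℝ => u y * (y : ℂ) ^ 1) (x + t * I)‖ ^ 2 +
        ‖weilMellin (fun y : ℝ => u y * (y : ℂ) ^ 2) (x + t * I)‖ ^ 2) =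
        (∫ t : ℝ, (‖weilMellin u (x + t * I)‖ ^ 2 +
          2 * ‖weilMellin (fun y : ℝ => u y * (y : ℂ) ^ 1) (x + t * I)‖ ^ 2)) +
        ∫ t : ℝ, ‖weilMellin (fun y : ℝ => u y * (y : ℂ) ^ 2) (x + t * I)‖ ^ 2 :=
      integral_add (h0i.add (h1i.const_mul 2)) h2i
    have e2 : ∫ t : ℝ, (‖weilMellin u (x + t * I)‖ ^ 2 +
          2 * ‖weilMellin (fun y : ℝ => u y * (y : ℂ) ^ 1) (x + t * I)‖ ^ 2) =
        (∫ t : ℝ, ‖weilMellin u (x + t * I)‖ ^ 2) +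
        ∫ t : ℝ, 2 * ‖weilMellin (fun y : ℝ => u y * (y : ℂ) ^ 1) (x + t * I)‖ ^ 2 :=
      integral_add h0i (h1i.const_mul 2)
    have e3 : ∫ t : ℝ, 2 * ‖weilMellin (fun y : ℝ => u y * (y : ℂ) ^ 1) (x + t * I)‖ ^ 2 =
        2 * ∫ t : ℝ, ‖weilMellin (fun y : ℝ => u y * (y : ℂ) ^ 1) (x + t * I)‖ ^ 2 :=
      integral_const_mul 2 _
    rw [e1, e2, e3]
    simp only [mul_zero, pow_zero, mul_one] at h0b h1b
    calc (∫ t : ℝ, ‖weilMellin u (x + t * I)‖ ^ 2) +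
          2 * (∫ t : ℝ, ‖weilMellin (fun y : ℝ => u y * (y : ℂ) ^ 1) (x + t * I)‖ ^ 2) +
          ∫ t : ℝ, ‖weilMellin (fun y : ℝ => u y * (y : ℂ) ^ 2) (x + t * I)‖ ^ 2
        ≤ 2 * π * Real.exp a * (∫ y : ℝ, ‖u y‖ ^ 2) +
          2 * (2 * π * a ^ 2 * Real.exp a * ∫ y : ℝ, ‖u y‖ ^ 2) +
          2 * π * a ^ (2 * 2) * Real.exp a * ∫ y : ℝ, ‖u y‖ ^ 2 := by
          gcongr
      _ = 2 * π * (1 + a ^ 2) ^ 2 * Real.exp a * ∫ y : ℝ, ‖u y‖ ^ 2 := by ring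
  have key := zeroSampling_main hC₀.le hcount hc0 hc1 hc2 hint hB hsample
  refine ⟨key.1, key.2.trans_eq ?_⟩
  ring

end Summit.RiemannHypothesis.RiemannHypothesis.Theorems.GroundStatesConvergeToXi

end
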